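import Summits.Ventures.QEC.Census.AdditiveGraphLanes
import HarnessLib

/-!
# Local-Clifford bridge: transferring a `k = 0` weight certificate from an LC-equivalent code (e.g. its graph form)

Venture QEC (cell `qec`), qec-search-5 gen 2. A self-dual additive code is certified most cheaply in GRAPH FORM
(`Census/AdditiveGraphLanes.lean`), which is a LOCAL-CLIFFORD image of the census matrix: per qubit one of the six invertible
`2 × 2` maps over `𝔽₂` on the letter `(x_q, z_q)` (the permutations of `{X, Y, Z}`), followed by row operations. Such a map
preserves the symplectic weight. This file transfers the conclusion «every nonzero element of `S` has weight `≥ d`» from the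
image code back to the ORIGINAL matrix by a kernel check — so the census object itself (not only its LC twin) gets a
standard-axiom `IsAdditiveCode _ 0 d`:

* `lcWord A B C D (x, z) = ((x ∧ A) ⊕ (z ∧ C), (x ∧ B) ⊕ (z ∧ D))` — the per-qubit linear map with bit masks
  (qubit `q`: `X ↦ (A_q, B_q)`, `Z ↦ (C_q, D_q)`); invertible at `q` iff `A_q D_q ⊕ B_q C_q = 1`.
* `AddCert.lcOK c A B C D G coefs` (definition): invertibility on the `n` qubits, and for every generator `r` of `c`:
  `lcWord r = xorPairs G coefsᵢ` (its image is an explicit combination of the rows `G` of the target certificate).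
* SOUNDNESS `AddCert.kzero_weights_of_lc` / `isAdditiveCode_zero_of_lc`: target weights `≥ d` on the span of `G` +
  `lcOK` + `checkStructureL` of `c` ⇒ `IsAdditiveCode c.code 0 d`.
Standard axioms; definitions + theorems.
-/

set_option autoImplicit false

namespace Summit.Ventures.QEC.Census

open Literature.InformationTheory.QuantumCodes List

/-- The local-Clifford map on packed Pauli words given by bit masks: `x' = (x ∧ A) ⊕ (z ∧ C)`, `z' = (x ∧ B) ⊕ (z ∧ D)`.
(definition) -/
def lcWord (A B C D : ℕ) (w : ℕ × ℕ) : ℕ × ℕ := ((w.1 &&& A) ^^^ (w.2 &&& C), (w.1 &&& B) ^^^ (w.2 &&& D))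

namespace AddCert

variable (c : AddCert)

/-- The LC-bridge check: the map is invertible on every qubit `< n` (`A_q D_q ⊕ B_q C_q = 1`) and the image of each
generator of `c` is the stated combination of the target rows `G`. (definition) -/
def lcOK (A B C D : ℕ) (G : List (ℕ × ℕ)) (coefs : List ℕ) : Bool :=
  ((List.range c.n).all fun i => ((A &&& D) ^^^ (B &&& C)).testBit i) &&
    (List.range c.rows.length).all fun i => xorPairs G (coefs.getD i 0) == lcWord A B C D (c.rows.getD i (0, 0))

end AddCert

/-! ## Soundness -/

/-- `lcWord` is additive. -/
theorem lcWord_xor (A B C D : ℕ) (a b : ℕ × ℕ) :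
    lcWord A B C D (a.1 ^^^ b.1, a.2 ^^^ b.2) =
      ((lcWord A B C D a).1 ^^^ (lcWord A B C D b).1, (lcWord A B C D a).2 ^^^ (lcWord A B C D b).2) := by
  simp only [lcWord]
  refine Prod.ext ?_ ?_ <;> apply Nat.eq_of_testBit_eq <;> intro i <;>
    simp only [Nat.testBit_xor, Nat.testBit_land] <;>
    cases a.1.testBit i <;> cases a.2.testBit i <;> cases b.1.testBit i <;> cases b.2.testBit i <;>
    cases A.testBit i <;> cases B.testBit i <;> cases C.testBit i <;> cases D.testBit i <;> rfl

/-- `lcWord 0 = 0`. -/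
theorem lcWord_zero (A B C D : ℕ) : lcWord A B C D (0, 0) = (0, 0) := by simp [lcWord]

/-- `lcWord` commutes with `xorPairs` (row combinations). -/
theorem xorPairs_map_lcWord (A B C D : ℕ) : ∀ (rows : List (ℕ × ℕ)) (u : ℕ),
    xorPairs (rows.map (lcWord A B C D)) u = lcWord A B C D (xorPairs rows u)
  | [], u => by simp [xorPairs, lcWord_zero]
  | r :: rest, u => by
    rw [List.map_cons, xorPairs, xorPairs, xorPairs_map_lcWord A B C D rest (u / 2)]
    split
    · rw [lcWord_xor]
    · rfl

/-- A combination of words that all lie in a subspace lies in it. -/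
theorem ofBitPair_xorPairs_mem {n : ℕ} (S : Submodule (ZMod 2) (SympVec n)) : ∀ (L : List (ℕ × ℕ)) (u : ℕ),
    (∀ r ∈ L, ofBitPair n r.1 r.2 ∈ S) → ofBitPair n (xorPairs L u).1 (xorPairs L u).2 ∈ S
  | [], u, _ => by simp [xorPairs, ofBitPair_zero]
  | r :: rest, u, h => by
    rw [xorPairs]
    have ih := ofBitPair_xorPairs_mem S rest (u / 2) fun r' hr' => h r' (List.mem_cons_of_mem _ hr')
    split
    · simp only
      rw [ofBitPair_xor]
      exact S.add_mem (h r (by simp)) ih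
    · exact ih

/-- **Invertible local maps preserve the symplectic weight** (bits `< n`). -/
theorem bitCount_lor_lcWord (n A B C D : ℕ) (hdet : ∀ i < n, ((A &&& D) ^^^ (B &&& C)).testBit i = true) (w : ℕ × ℕ) :
    bitCount n ((lcWord A B C D w).1 ||| (lcWord A B C D w).2) = bitCount n (w.1 ||| w.2) := by
  rw [bitCount_eq_sum, bitCount_eq_sum]
  refine Finset.sum_congr rfl fun i _ => ?_
  have h := hdet i.1 i.2
  simp only [Nat.testBit_xor, Nat.testBit_land] at h
  simp only [lcWord, Nat.testBit_lor, Nat.testBit_xor, Nat.testBit_land]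
  revert h
  cases w.1.testBit i <;> cases w.2.testBit i <;> cases A.testBit i <;> cases B.testBit i <;> cases C.testBit i <;>
    cases D.testBit i <;> decide

namespace AddCert

variable (c : AddCert)

/-- Every row of a certificate lies in its code. -/
theorem ofBitPair_row_mem_code : ∀ r ∈ c.rows, ofBitPair c.n r.1 r.2 ∈ c.code := by
  intro r hr
  obtain ⟨i, hi, rfl⟩ := List.getElem_of_mem hr
  have : c.rowVec ⟨i, hi⟩ ∈ c.code := Submodule.subset_span ⟨⟨i, hi⟩, rfl⟩
  rwa [rowVec_apply] at this

/-- **LC bridge, weight form**: if every nonzero vector of `S` has weight `≥ d`, and the LC images of the generators of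
`c` are combinations of words `G` lying in `S`, with the map invertible on the `n` qubits, then every nonzero element of
`c.code` has weight `≥ d`. -/
theorem kzero_weights_of_lc (S : Submodule (ZMod 2) (SympVec c.n)) (d A B C D : ℕ) (G : List (ℕ × ℕ))
    (coefs : List ℕ) (hS : ∀ v ∈ S, v ≠ 0 → d ≤ sympWeight v) (hG : ∀ r ∈ G, ofBitPair c.n r.1 r.2 ∈ S)
    (hlc : c.lcOK A B C D G coefs = true) : ∀ v ∈ c.code, v ≠ 0 → d ≤ sympWeight v := by
  simp only [lcOK, Bool.and_eq_true, List.all_eq_true, List.mem_range, beq_iff_eq] at hlc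
  obtain ⟨hdet, hrows⟩ := hlc
  intro v hv hv0
  obtain ⟨u, -, rfl⟩ := c.exists_xorPairs_of_mem_code hv
  -- the image of the combination is the combination of the images, which lies in `S`
  have himg : ofBitPair c.n (lcWord A B C D (xorPairs c.rows u)).1 (lcWord A B C D (xorPairs c.rows u)).2 ∈ S := by
    rw [← xorPairs_map_lcWord]
    refine ofBitPair_xorPairs_mem S _ u fun r hr => ?_
    obtain ⟨r0, hr0, rfl⟩ := List.mem_map.1 hr
    obtain ⟨i, hi, rfl⟩ := List.getElem_of_mem hr0
    have := hrows i hi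
    rw [List.getD_eq_getElem _ _ hi] at this
    rw [← this]
    exact ofBitPair_xorPairs_mem S G _ hG
  -- weights agree
  have hw : sympWeight (ofBitPair c.n (lcWord A B C D (xorPairs c.rows u)).1 (lcWord A B C D (xorPairs c.rows u)).2) =
      sympWeight (ofBitPair c.n (xorPairs c.rows u).1 (xorPairs c.rows u).2) := by
    rw [Summit.Ventures.QEC.sympWeight_ofBitPair, Summit.Ventures.QEC.sympWeight_ofBitPair,
      bitCount_lor_lcWord c.n A B C D hdet]
  have hne : ofBitPair c.n (lcWord A B C D (xorPairs c.rows u)).1 (lcWord A B C D (xorPairs c.rows u)).2 ≠ 0 := by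
    intro h0
    have h1 : sympWeight (ofBitPair c.n (xorPairs c.rows u).1 (xorPairs c.rows u).2) = 0 := by
      rw [← hw, h0]; exact (sympWeight_eq_zero_iff _).2 rfl
    exact hv0 ((sympWeight_eq_zero_iff _).1 h1)
  rw [← hw]
  exact hS _ himg hne

/-- **LC bridge, `[[n, 0, d]]` form**: structural checks of `c` + an LC-equivalent `[[n, 0, d]]` target. -/
theorem isAdditiveCode_zero_of_lc (S : Submodule (ZMod 2) (SympVec c.n)) (A B C D : ℕ) (G : List (ℕ × ℕ))
    (coefs : List ℕ) (hs : c.checkStructureL = true) (hn : c.rows.length = c.n)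
    (hS : ∀ v ∈ S, v ≠ 0 → c.d ≤ sympWeight v) (hG : ∀ r ∈ G, ofBitPair c.n r.1 r.2 ∈ S)
    (hlc : c.lcOK A B C D G coefs = true) : IsAdditiveCode c.code 0 c.d := by
  rw [checkStructureL, Bool.and_eq_true] at hs
  have hs' := hs.1
  simp only [checkStructure, Bool.and_eq_true, decide_eq_true_eq] at hs'
  obtain ⟨⟨⟨hcomm, hind⟩, -⟩, -⟩ := hs'
  have hso := c.isSelfOrthogonal_code hcomm
  have hdim := c.finrank_code hind
  have hSS : sympDual c.code = c.code := by
    refine (Submodule.eq_of_le_of_finrank_le hso ?_).symm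
    have := finrank_sympDual_add c.code
    omega
  exact ⟨hso, by rw [hdim, hn, Nat.add_zero], fun w hw hw' => absurd (hSS ▸ hw) hw',
    fun _ => c.kzero_weights_of_lc S c.d A B C D G coefs hS hG hlc⟩

end AddCert

end Summit.Ventures.QEC.Census
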